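import Summits.KontsevichZagierPeriods.KontsevichZagierPeriods.Theses.HurwitzMicroSectors
import Literature.NumberTheory.Transcendental.LindemannWeierstrassProofs

/-!
# `HurwitzSectorComplement` (stmt-KontsevichZagierPeriods-14341, route HurwitzMicroSectors) — line
`galois-parity-half`, stub `stub_rigidityNumbers` (S5)

Pure algebra: the rigidity of the numbers `c + Σ_{a ∈ T_L} μ_a K(w,L,a)` (`c, μ_a ∈ ℚ`), where
`T_L = {0 < a < L/2, gcd(a,L) = 1}` and
`K(w,L,a) = Σ_k (Lk+a)^{-w} + (-1)^w Σ_k (Lk+L-a)^{-w}`, GIVEN as hypotheses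
(H1) each `K(w,L,a)/π^w` is algebraic (stub S3) and (H2) the `K(w,L,a)`, `a ∈ T_L`, are
`ℚ`-linearly independent (stub S4, Okada). With `α := Σ μ_a K(w,L,a)/π^w`,
`α' := Σ μ'_a K(w',L,a)/π^{w'}` (real algebraic numbers), an equality of two such numbers reads
`(c - c') + α π^w - α' π^{w'} = 0`. Since `π` is transcendental over `ℚ` (Lindemann,
`transcendental_pi_holds`), it is transcendental over the subalgebra of real algebraic numbers
(`Transcendental.subalgebraAlgebraicClosure`), so all coefficients of this polynomial relation
vanish: `c = c'`, and `α = α' = 0` if `w ≠ w'` (resp. `α = α'` if `w = w'`); then (H2) gives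
`μ = μ' = 0` (resp. `μ = μ'`) on `T_L`.

## References

* F. Lindemann, *Über die Zahl π*, Math. Ann. 20 (1882).
* T. Okada, *On an extension of a theorem of S. Chowla*, Acta Arith. 38 (1981).
* M. Kontsevich, D. Zagier, *Periods* (2001), §1.2.
-/

noncomputable section

open Set MeasureTheory
open scoped BigOperators
open Literature.NumberTheory.Transcendental

namespace Summit.KontsevichZagierPeriods.Theorems.HurwitzMicroSectorsHurwitzSectorComplement

namespace RigidityNumbers

open Polynomial

/-- If `β₀ + β₁ π^w + β₂ π^{w'} = 0` with `βᵢ` real algebraic numbers and `w, w'` distinct positive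
exponents, then all `βᵢ` vanish: otherwise `π` would be a root of the nonzero polynomial
`β₀ + β₁ X^w + β₂ X^{w'}` over the subalgebra of real algebraic numbers, over which `π` is still
transcendental (`transcendental_pi_holds` and `Transcendental.subalgebraAlgebraicClosure`).
[folklore] -/
theorem coeffs_eq_zero {β₀ β₁ β₂ : ℝ} (h₀ : IsAlgebraic ℚ β₀) (h₁ : IsAlgebraic ℚ β₁)
    (h₂ : IsAlgebraic ℚ β₂) {w w' : ℕ} (hw : w ≠ 0) (hw' : w' ≠ 0) (hne : w ≠ w')
    (h : β₀ + β₁ * Real.pi ^ w + β₂ * Real.pi ^ w' = 0) : β₀ = 0 ∧ β₁ = 0 ∧ β₂ = 0 := by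
  have hπ : Transcendental ℚ Real.pi := transcendental_pi_holds
  have hπ' : Transcendental (Subalgebra.algebraicClosure ℚ ℝ) Real.pi :=
    hπ.subalgebraAlgebraicClosure
  obtain ⟨b₀, hb₀⟩ : ∃ b : Subalgebra.algebraicClosure ℚ ℝ, (b : ℝ) = β₀ := ⟨⟨β₀, h₀⟩, rfl⟩
  obtain ⟨b₁, hb₁⟩ : ∃ b : Subalgebra.algebraicClosure ℚ ℝ, (b : ℝ) = β₁ := ⟨⟨β₁, h₁⟩, rfl⟩
  obtain ⟨b₂, hb₂⟩ : ∃ b : Subalgebra.algebraicClosure ℚ ℝ, (b : ℝ) = β₂ := ⟨⟨β₂, h₂⟩, rfl⟩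
  have hp : (C b₀ + C b₁ * X ^ w + C b₂ * X ^ w' : (Subalgebra.algebraicClosure ℚ ℝ)[X]) = 0 := by
    refine transcendental_iff.mp hπ' _ ?_
    simp only [map_add, map_mul, map_pow, aeval_C, aeval_X, Subalgebra.algebraMap_def, hb₀, hb₁,
      hb₂]
    exact h
  have e₀ := congrArg (fun p : (Subalgebra.algebraicClosure ℚ ℝ)[X] => p.coeff 0) hp
  have e₁ := congrArg (fun p : (Subalgebra.algebraicClosure ℚ ℝ)[X] => p.coeff w) hp
  have e₂ := congrArg (fun p : (Subalgebra.algebraicClosure ℚ ℝ)[X] => p.coeff w') hp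
  simp only [coeff_add, coeff_C_mul_X_pow, coeff_C, coeff_zero, if_true, if_neg hw, if_neg hw',
    if_neg hne, if_neg (Ne.symm hw), if_neg (Ne.symm hw'), if_neg (Ne.symm hne), add_zero,
    zero_add] at e₀ e₁ e₂
  refine ⟨?_, ?_, ?_⟩
  · rw [← hb₀, e₀]; rfl
  · rw [← hb₁, e₁]; rfl
  · rw [← hb₂, e₂]; rfl

/-- The rational coefficients of a vanishing combination of a `ℚ`-linearly independent family of
reals indexed by a finset all vanish. [folklore] -/
theorem rat_coeffs_eq_zero {T : Finset ℕ} {f : ℕ → ℝ}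
    (hli : LinearIndependent ℚ (fun a : {a : ℕ // a ∈ T} => f a.1)) {ν : ℕ → ℚ}
    (hsum : ∑ a ∈ T, (ν a : ℝ) * f a = 0) : ∀ a ∈ T, ν a = 0 := by
  intro a ha
  refine Fintype.linearIndependent_iff.mp hli (fun i => ν i.1) ?_ ⟨a, ha⟩
  rw [← Finset.sum_coe_sort] at hsum
  simpa [Rat.smul_def] using hsum

/-- Factoring `π^v` out of a rational combination. [folklore] -/
theorem sum_eq_mul_pow (T : Finset ℕ) (g : ℕ → ℝ) (ν : ℕ → ℚ) (v : ℕ) :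
    ∑ a ∈ T, (ν a : ℝ) * g a = (∑ a ∈ T, (ν a : ℝ) * (g a / Real.pi ^ v)) * Real.pi ^ v := by
  rw [Finset.sum_mul]
  refine Finset.sum_congr rfl fun a _ => ?_
  rw [mul_assoc, div_mul_cancel₀ _ (pow_ne_zero _ Real.pi_ne_zero)]

/-- A rational combination of real algebraic numbers is algebraic. [folklore] -/
theorem isAlgebraic_sum (T : Finset ℕ) (g : ℕ → ℝ) (ν : ℕ → ℚ)
    (hg : ∀ a ∈ T, IsAlgebraic ℚ (g a)) : IsAlgebraic ℚ (∑ a ∈ T, (ν a : ℝ) * g a) :=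
  (Subalgebra.mem_algebraicClosure ℚ ℝ).mp <|
    Subalgebra.sum_mem _ fun a ha => Subalgebra.mul_mem _ (isAlgebraic_rat ℚ (ν a)) (hg a ha)

/-- **Abstract rigidity.** For a finset `T` and numbers `K v a` (`v ≥ 2`, `a ∈ T`) such that each
`K v a / π^v` is algebraic and, for each `v ≥ 2`, the `K v a`, `a ∈ T`, are `ℚ`-linearly
independent, an equality `c + Σ_{a ∈ T} μ_a K w a = c' + Σ_{a ∈ T} μ'_a K w' a` with rational
`c, c', μ, μ'` forces `c = c'`, `μ = μ'` on `T` if `w = w'`, and `μ = μ' = 0` on `T` if `w ≠ w'`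
(transcendence of `π`, `coeffs_eq_zero`). [folklore] -/
theorem rigidity_abstract (T : Finset ℕ) (K : ℕ → ℕ → ℝ)
    (halg : ∀ v a, 2 ≤ v → a ∈ T → IsAlgebraic ℚ (K v a / Real.pi ^ v))
    (hli : ∀ v, 2 ≤ v → LinearIndependent ℚ (fun a : {a : ℕ // a ∈ T} => K v a.1))
    (w w' : ℕ) (c c' : ℚ) (μ μ' : ℕ → ℚ) (hw : 2 ≤ w) (hw' : 2 ≤ w')
    (heq : (c : ℝ) + ∑ a ∈ T, (μ a : ℝ) * K w a = (c' : ℝ) + ∑ a ∈ T, (μ' a : ℝ) * K w' a) :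
    c = c' ∧ (w = w' → ∀ a ∈ T, μ a = μ' a) ∧ (w ≠ w' → ∀ a ∈ T, μ a = 0 ∧ μ' a = 0) := by
  -- the normalised (algebraic) coefficients `α`, `α'`
  obtain ⟨α, hα⟩ : ∃ α : ℝ, α = ∑ a ∈ T, (μ a : ℝ) * (K w a / Real.pi ^ w) := ⟨_, rfl⟩
  obtain ⟨α', hα'⟩ : ∃ α' : ℝ, α' = ∑ a ∈ T, (μ' a : ℝ) * (K w' a / Real.pi ^ w') := ⟨_, rfl⟩
  have hαalg : IsAlgebraic ℚ α := hα ▸ isAlgebraic_sum T _ μ fun a ha => halg w a hw ha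
  have hα'alg : IsAlgebraic ℚ α' := hα' ▸ isAlgebraic_sum T _ μ' fun a ha => halg w' a hw' ha
  have hS : ∑ a ∈ T, (μ a : ℝ) * K w a = α * Real.pi ^ w := by
    rw [hα]; exact sum_eq_mul_pow T (K w) μ w
  have hS' : ∑ a ∈ T, (μ' a : ℝ) * K w' a = α' * Real.pi ^ w' := by
    rw [hα']; exact sum_eq_mul_pow T (K w') μ' w'
  rw [hS, hS'] at heq
  by_cases hww : w = w'
  · subst hww
    -- `(c - c') + (α - α') π^w + 0 · π^(w+1) = 0`
    obtain ⟨e₀, e₁, -⟩ := coeffs_eq_zero (β₀ := ((c - c' : ℚ) : ℝ)) (β₁ := α - α') (β₂ := 0)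
      (w := w) (w' := w + 1) (isAlgebraic_rat ℚ _) (hαalg.sub hα'alg) isAlgebraic_zero
      (by omega) (by omega) (by omega) (by push_cast; linear_combination heq)
    have hcc : c - c' = 0 := by exact_mod_cast e₀
    refine ⟨sub_eq_zero.mp hcc, fun _ a ha => ?_, fun h => absurd rfl h⟩
    have hsum : ∑ a ∈ T, ((μ a - μ' a : ℚ) : ℝ) * K w a = 0 := by
      rw [sum_eq_mul_pow T (K w) _ w]
      have : ∑ a ∈ T, ((μ a - μ' a : ℚ) : ℝ) * (K w a / Real.pi ^ w) = α - α' := by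
        rw [hα, hα', ← Finset.sum_sub_distrib]
        refine Finset.sum_congr rfl fun a _ => ?_
        push_cast; ring
      rw [this, e₁, zero_mul]
    exact sub_eq_zero.mp (rat_coeffs_eq_zero (hli w hw) hsum a ha)
  · -- `(c - c') + α π^w + (-α') π^(w') = 0`
    obtain ⟨e₀, e₁, e₂⟩ := coeffs_eq_zero (β₀ := ((c - c' : ℚ) : ℝ)) (β₁ := α) (β₂ := -α')
      (w := w) (w' := w') (isAlgebraic_rat ℚ _) hαalg hα'alg.neg
      (by omega) (by omega) hww (by push_cast; linear_combination heq)
    have hcc : c - c' = 0 := by exact_mod_cast e₀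
    refine ⟨sub_eq_zero.mp hcc, fun h => absurd h hww, fun _ a ha => ⟨?_, ?_⟩⟩
    · have hsum : ∑ a ∈ T, (μ a : ℝ) * K w a = 0 := by rw [hS, e₁, zero_mul]
      exact rat_coeffs_eq_zero (hli w hw) hsum a ha
    · have hsum : ∑ a ∈ T, (μ' a : ℝ) * K w' a = 0 := by rw [hS', neg_eq_zero.mp e₂, zero_mul]
      exact rat_coeffs_eq_zero (hli w' hw') hsum a ha

end RigidityNumbers

open RigidityNumbers in
/-- **S5 (rigidity of the numbers, from S3 + S4 + Lindemann).** Given (H1) the algebraicity of the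
`K(w,L,a)/π^w` and (H2) the `ℚ`-linear independence of the `K(w,L,a)`, `a ∈ T_L` (Okada), an
equality `c + Σ_{a ∈ T_L} μ_a K(w,L,a) = c' + Σ_{a ∈ T_L} μ'_a K(w',L,a)` of two normal-form values
forces `c = c'`, and `μ = μ'` on `T_L` if `w = w'`, resp. `μ = μ' = 0` on `T_L` if `w ≠ w'`
(`RigidityNumbers.rigidity_abstract`; `a ∈ T_L` has `0 < a < L` since `gcd(0,L) = L ≥ 3`).
[folklore] -/
theorem stub_rigidityNumbers : (∀ (w L a : ℕ), 2 ≤ w → 0 < a → a < L → IsAlgebraic ℚ (((∑' k : ℕ, 1 / ((L : ℝ) * k + a) ^ w) + (-1 : ℝ) ^ w * (∑' k : ℕ, 1 / ((L : ℝ) * k + ((L : ℝ) - a)) ^ w)) / Real.pi ^ w)) → (∀ (w L : ℕ), 2 ≤ w → 3 ≤ L → LinearIndependent ℚ (fun a : {a : ℕ // a ∈ (Finset.range L).filter (fun a => 2 * a < L ∧ Nat.Coprime a L)} => (∑' k : ℕ, 1 / ((L : ℝ) * k + a.1) ^ w) + (-1 : ℝ) ^ w * (∑' k : ℕ, 1 /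 ((L : ℝ) * k + ((L : ℝ) - a.1)) ^ w))) → ∀ (w w' L : ℕ) (c c' : ℚ) (μ μ' : ℕ → ℚ), 2 ≤ w → 2 ≤ w' → 3 ≤ L → (c : ℝ) + ∑ a ∈ (Finset.range L).filter (fun a => 2 * a < L ∧ Nat.Coprime a L), (μ a : ℝ) * ((∑' k : ℕ, 1 / ((L : ℝ) * k + a) ^ w) + (-1 : ℝ) ^ w * (∑' k : ℕ, 1 / ((L : ℝ) * k + ((L : ℝ) - a)) ^ w)) = (c' : ℝ) + ∑ a ∈ (Finset.range L).filter (fun a => 2 * a < L ∧ Nat.Coprime a L), (μ' a : ℝ) * ((∑' k : ℕ, 1 / ((L : ℝ) * k + a) ^ w') + (-1 : ℝ) ^ w' * (∑' k : ℕ, 1 / ((L : ℝ) * k + ((L : ℝ) - a)) ^ w')) → c = c' ∧ (w = w' → ∀ a ∈ (Finset.range L).filter (fun a => 2 * a < L ∧ Nat.Coprime a L), μ a = μ' a) ∧ (w ≠ w' → ∀ a ∈ (Finset.range L).filter (fun a => 2 * a < L ∧ Nat.Coprime a L), μ a = 0 ∧ μ' a = 0) := by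
  intro H1 H2 w w' L c c' μ μ' hw hw' hL heq
  have hpos : ∀ a ∈ (Finset.range L).filter (fun a => 2 * a < L ∧ Nat.Coprime a L),
      0 < a ∧ a < L := by
    intro a ha
    simp only [Finset.mem_filter, Finset.mem_range] at ha
    refine ⟨Nat.pos_of_ne_zero fun h0 => ?_, ha.1⟩
    subst h0
    have h1 : L = 1 := (Nat.coprime_zero_left L).mp ha.2.2
    omega
  exact rigidity_abstract ((Finset.range L).filter (fun a => 2 * a < L ∧ Nat.Coprime a L))
    (fun v a => (∑' k : ℕ, 1 / ((L : ℝ) * k + a) ^ v) +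
      (-1 : ℝ) ^ v * (∑' k : ℕ, 1 / ((L : ℝ) * k + ((L : ℝ) - a)) ^ v))
    (fun v a hv ha => H1 v L a hv (hpos a ha).1 (hpos a ha).2) (fun v hv => H2 v L hv hL)
    w w' c c' μ μ' hw hw' heq

end Summit.KontsevichZagierPeriods.Theorems.HurwitzMicroSectorsHurwitzSectorComplement

end
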